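import Summits.HodgeConjecture.HodgeConjecture.Theorems.LinearSystemTorelliLocalTubeSpanFrameLiftBasic

/-!
# Route LinearSystemTorelli — crux `LocalTubeSpan` (stmt-HodgeConjecture-2490): plane calculus of squared transvections

Helper file (`--supports stmt-HodgeConjecture-2490`, line `Sketch` of the crux chain, cycle 7,
continuation lead c6; the lead's stub `stub_planeCalculus`): plane calculus — the word
`T_x² T_y² T_{x+y}² = -1` on a unimodular plane, and powers of squared transvections; inputs of the
unimodular transitivity of the level-2 elementary moves.

For an alternating form `B` on a `ℚ`-vector space `V` (`T_a x = x - B(x, a) a`, `skewTransvection`):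

* `localTubeSpan_skewTransvection_sq_apply` — `T_a (T_a u) = u - 2 B(u, a) a`;
* `localTubeSpan_negOnPlane` — for a unimodular pair `B(x, y) = 1` the word `T_x² T_y² T_{x+y}²`
  acts as `v ↦ v - 2 (B(v, y) x - B(v, x) y)`, i.e. as `-1` on the plane `ℚx ⊕ ℚy` and trivially
  on its `B`-orthogonal;
* `localTubeSpan_sqMove_pow_apply`, `localTubeSpan_sqMove_inv_apply`,
  `localTubeSpan_sqMove_inv_pow_apply` — a unit `g` of `End V` acting as `T_a²`,
  `v ↦ v - 2 B(v, a) a`, has `gᵐ v = v - 2m B(v, a) a` and `g⁻ᵐ v = v + 2m B(v, a) a`;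
* `localTubeSpan_planeCalculus` — the registered conjunction of the two.

No named facts; no `sorry`.
-/

-- `Summit.HodgeConjecture.HodgeConjecture.Theorems` is the mandated namespace (single-conjunct summit:
-- Sub = Summit), which `linter.dupNamespace` flags on every declaration; the lakefile turns the
-- linter off tree-wide (weak option), restated here so stand-alone elaboration is warning-free too.
set_option linter.dupNamespace false

noncomputable section

open Literature.AlgebraicGeometry.HodgeTheory

namespace Summit.HodgeConjecture.HodgeConjecture.Theorems

/-! ### Squared transvections of an alternating form -/

section PlaneCalculus

variable {V : Type} [AddCommGroup V] [Module ℚ V]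

/-- The square of a transvection of an alternating form: `T_a (T_a u) = u - 2 B(u, a) a`
(`B(a, a) = 0`). [folklore] -/
theorem localTubeSpan_skewTransvection_sq_apply (B : LinearMap.BilinForm ℚ V) (hB : B.IsAlt)
    (a u : V) :
    skewTransvection B a (skewTransvection B a u) = u - (2 : ℚ) • (B u a • a) := by
  rw [skewTransvection_apply, skewTransvection_apply, map_sub, map_smul, LinearMap.sub_apply,
    LinearMap.smul_apply, hB.self_eq_zero a, smul_eq_mul, mul_zero, sub_zero]
  module

/-- **The word `T_x² T_y² T_{x+y}²` is `-1` on a unimodular plane.** For an alternating form `B`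
and `B(x, y) = 1`, the product of the squared transvections along `x`, `y`, `x + y` acts as
`v ↦ v - 2 (B(v, y) x - B(v, x) y)`: it is `-1` on `ℚx ⊕ ℚy` (`x ↦ -x`, `y ↦ -y`) and the identity
on the `B`-orthogonal of the plane. [folklore] -/
theorem localTubeSpan_negOnPlane (B : LinearMap.BilinForm ℚ V) (hB : B.IsAlt) {x y : V}
    (hxy : B x y = 1) (v : V) :
    skewTransvection B x (skewTransvection B x (skewTransvection B y (skewTransvection B y
      (skewTransvection B (x + y) (skewTransvection B (x + y) v))))) =
      v - (2 : ℚ) • (B v y • x - B v x • y) := by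
  have hxx : B x x = 0 := hB.self_eq_zero x
  have hyy : B y y = 0 := hB.self_eq_zero y
  have hyx : B y x = -1 := by rw [← hB.neg_eq, hxy]
  simp only [localTubeSpan_skewTransvection_sq_apply B hB, map_sub, map_smul, map_add, hxy, hyx,
    hxx, hyy]
  module

/-- Powers of a unit `g` of `End V` acting as a squared transvection `T_a²`, `v ↦ v - 2 B(v, a) a`,
of an alternating form: `gᵐ v = v - 2m B(v, a) a`. [folklore] -/
theorem localTubeSpan_sqMove_pow_apply (B : LinearMap.BilinForm ℚ V) (hB : B.IsAlt) (a : V)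
    (g : (V →ₗ[ℚ] V)ˣ) (hg : ∀ v, (g : V →ₗ[ℚ] V) v = v - (2 : ℚ) • (B v a • a)) (m : ℕ) (v : V) :
    ((g ^ m : (V →ₗ[ℚ] V)ˣ) : V →ₗ[ℚ] V) v = v - (2 * m : ℚ) • (B v a • a) := by
  induction m with
  | zero =>
    rw [pow_zero, Units.val_one, Module.End.one_apply, Nat.cast_zero, mul_zero, zero_smul,
      sub_zero]
  | succ n ih =>
    rw [pow_succ', Units.val_mul, Module.End.mul_apply, ih, hg]
    simp only [map_sub, map_smul, LinearMap.sub_apply, LinearMap.smul_apply, smul_eq_mul,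
      hB.self_eq_zero a, mul_zero, sub_zero, Nat.cast_succ]
    module

/-- The inverse of a unit `g` of `End V` acting as a squared transvection `T_a²`,
`v ↦ v - 2 B(v, a) a`, of an alternating form acts as `v ↦ v + 2 B(v, a) a`. [folklore] -/
theorem localTubeSpan_sqMove_inv_apply (B : LinearMap.BilinForm ℚ V) (hB : B.IsAlt) (a : V)
    (g : (V →ₗ[ℚ] V)ˣ) (hg : ∀ v, (g : V →ₗ[ℚ] V) v = v - (2 : ℚ) • (B v a • a)) (v : V) :
    ((g⁻¹ : (V →ₗ[ℚ] V)ˣ) : V →ₗ[ℚ] V) v = v + (2 : ℚ) • (B v a • a) := by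
  have h1 : (g : V →ₗ[ℚ] V) (v + (2 : ℚ) • (B v a • a)) = v := by
    rw [hg]
    simp only [map_add, map_smul, LinearMap.add_apply, LinearMap.smul_apply, smul_eq_mul,
      hB.self_eq_zero a, mul_zero, add_zero, add_sub_cancel_right]
  calc ((g⁻¹ : (V →ₗ[ℚ] V)ˣ) : V →ₗ[ℚ] V) v
      = ((g⁻¹ : (V →ₗ[ℚ] V)ˣ) : V →ₗ[ℚ] V) ((g : V →ₗ[ℚ] V) (v + (2 : ℚ) • (B v a • a))) := by
        rw [h1]
    _ = v + (2 : ℚ) • (B v a • a) := localTubeSpan_units_inv_apply_apply g _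

/-- Negative powers of a unit `g` of `End V` acting as a squared transvection `T_a²`,
`v ↦ v - 2 B(v, a) a`, of an alternating form: `g⁻ᵐ v = v + 2m B(v, a) a`. [folklore] -/
theorem localTubeSpan_sqMove_inv_pow_apply (B : LinearMap.BilinForm ℚ V) (hB : B.IsAlt) (a : V)
    (g : (V →ₗ[ℚ] V)ˣ) (hg : ∀ v, (g : V →ₗ[ℚ] V) v = v - (2 : ℚ) • (B v a • a)) (m : ℕ) (v : V) :
    ((g⁻¹ ^ m : (V →ₗ[ℚ] V)ˣ) : V →ₗ[ℚ] V) v = v + (2 * m : ℚ) • (B v a • a) := by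
  induction m with
  | zero =>
    rw [pow_zero, Units.val_one, Module.End.one_apply, Nat.cast_zero, mul_zero, zero_smul,
      add_zero]
  | succ n ih =>
    rw [pow_succ', Units.val_mul, Module.End.mul_apply, ih, localTubeSpan_sqMove_inv_apply B hB a g hg]
    simp only [map_add, map_smul, LinearMap.add_apply, LinearMap.smul_apply, smul_eq_mul,
      hB.self_eq_zero a, mul_zero, add_zero, Nat.cast_succ]
    module

/-- **Plane calculus of squared transvections** (alternating `B`): (i) for a unimodular pair
`B(x, y) = 1` the word `T_x² T_y² T_{x+y}²` acts as `v ↦ v - 2 (B(v, y) x - B(v, x) y)` (`-1` on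
the plane `ℚx ⊕ ℚy`, the identity on its orthogonal); (ii) a unit `g` of `End V` acting as `T_a²`,
`v ↦ v - 2 B(v, a) a`, has `gᵐ v = v - 2m B(v, a) a` and `g⁻ᵐ v = v + 2m B(v, a) a`. [folklore] -/
theorem localTubeSpan_planeCalculus (B : LinearMap.BilinForm ℚ V) (hB : B.IsAlt) :
    (∀ x y : V, B x y = 1 → ∀ v : V,
      skewTransvection B x (skewTransvection B x (skewTransvection B y (skewTransvection B y
        (skewTransvection B (x + y) (skewTransvection B (x + y) v))))) =
        v - (2 : ℚ) • (B v y • x - B v x • y)) ∧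
    (∀ (a : V) (g : (V →ₗ[ℚ] V)ˣ),
      (∀ v, ((g : (V →ₗ[ℚ] V)ˣ) : V →ₗ[ℚ] V) v = v - (2 : ℚ) • (B v a • a)) →
      ∀ (m : ℕ) (v : V),
        (((g ^ m : (V →ₗ[ℚ] V)ˣ)) : V →ₗ[ℚ] V) v = v - (2 * m : ℚ) • (B v a • a) ∧
        (((g⁻¹ ^ m : (V →ₗ[ℚ] V)ˣ)) : V →ₗ[ℚ] V) v = v + (2 * m : ℚ) • (B v a • a)) :=
  ⟨fun _ _ hxy v => localTubeSpan_negOnPlane B hB hxy v, fun a g hg m v =>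
    ⟨localTubeSpan_sqMove_pow_apply B hB a g hg m v,
      localTubeSpan_sqMove_inv_pow_apply B hB a g hg m v⟩⟩

end PlaneCalculus

end Summit.HodgeConjecture.HodgeConjecture.Theorems

end
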